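import Summits.ValiantsHypothesis.ValiantsHypothesis.Theorems.LacunarySymmetroidMatrixDescartesDoorA26WallBubblingTwoWeylPairsSingleCluster

/-!
# Wall bubbling for `DoorA26` — TWO WEYL PAIRS at ARBITRARY positions: relabelling the door-free single-cluster theorems

HONEST FRAMING.  Obligation (W) `stub_weylFaces` of `Cruxes/DoorA26/Lines/wall_bubbling.lean` (crux `DoorA26`, stmt-ValiantsHypothesis-19979;
OPEN, typed, never asserted); statement file `Cruxes/DoorA26/Lines/wall_bubbling_ConfluentDoor.lean` rev 4 (two-pair strata of
`Stmt.weylFaces_deepVal` / `Stmt.weylFaces_wall`).  W1 seat val-sym-door-p2 g13 (#29).  W1 #28 `…TwoWeylPairsSingleCluster` fixes the positions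
(pair A at `0,5`, pair B at `1,4`, singles at `2,3`); this file transports its eight door-free theorems to ANY placement of the two pairs by a
permutation `σ` of the six positions (def-free):

* `exists_perm_twoWeylPairs` — for distinct positions `i, j, i′, j′` there is `σ : Equiv.Perm (Fin 6)` with `σ 0 = i`, `σ 5 = j`, `σ 1 = i′`,
  `σ 4 = j′` (four swaps);
* `no_twenty_window_twoWeylPairs_perm`, `…_wallC1_perm`, `…_wallC2_perm`, `…_wallC3_perm` and `no_boundedRatio_twenties_twoWeylPairs_perm`,
  `…_wallC1_perm`, `…_wallC2_perm`, `…_wallC3_perm` — the theorems of #28 for exponents `δ0 ∘ σ`-placed pairs: hypotheses on `δ0 (σ 5) = δ0 (σ 0)`,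
  `δ0 (σ 4) = δ0 (σ 1)` and the genericity / wall relation of the four values `δ0 (σ 0), δ0 (σ 1), δ0 (σ 2), δ0 (σ 3)`; the pencils themselves are
  NOT relabelled (`Equiv.sum_comp`).

Registers unchanged; (W), `ConfluentDoor26`, `DoorA26`, `MatrixDescartes` (stmt-ValiantsHypothesis-18050) OPEN; nothing on VP ≠ VNP.
`--supports stmt-ValiantsHypothesis-19979 --as helper`.  [folklore] relabelling.
-/

-- `Summit.ValiantsHypothesis.ValiantsHypothesis.…` repeats a component by the D-0017 layout
-- (single-conjunct summit), which the `dupNamespace` linter flags; the name is mandated.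
set_option linter.dupNamespace false

namespace Summit.ValiantsHypothesis.ValiantsHypothesis.Theorems.LacunarySymmetroidMatrixDescartes.WallBubbling

open Finset Filter Topology
open Bubbling (polar)
open scoped BigOperators

/-! ## 1. A permutation placing the two pairs -/

/-- **A permutation of the six positions with prescribed DISTINCT values at `0, 5, 1, 4`** (four swaps). [folklore] -/
theorem exists_perm_twoWeylPairs (i j i' j' : Fin 6) (hij : i ≠ j) (hii' : i ≠ i') (hij' : i ≠ j') (hji' : j ≠ i') (hjj' : j ≠ j')
    (hi'j' : i' ≠ j') :
    ∃ σ : Equiv.Perm (Fin 6), σ 0 = i ∧ σ 5 = j ∧ σ 1 = i' ∧ σ 4 = j' := by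
  classical
  -- step 1: `0 ↦ i`
  set σ₁ : Equiv.Perm (Fin 6) := Equiv.swap 0 i with hσ₁
  have h1_0 : σ₁ 0 = i := by rw [hσ₁, Equiv.swap_apply_left]
  -- step 2: `5 ↦ j`, keeping `0 ↦ i`
  set b₂ := σ₁.symm j with hb₂
  have hb₂0 : b₂ ≠ 0 := by
    intro h
    apply hij
    rw [← h1_0, ← h]; simp [hb₂]
  set σ₂ : Equiv.Perm (Fin 6) := σ₁ * Equiv.swap 5 b₂ with hσ₂
  have h2_0 : σ₂ 0 = i := by
    rw [hσ₂, Equiv.Perm.mul_apply, Equiv.swap_apply_of_ne_of_ne (by decide) hb₂0.symm, h1_0]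
  have h2_5 : σ₂ 5 = j := by
    rw [hσ₂, Equiv.Perm.mul_apply, Equiv.swap_apply_left]; simp [hb₂]
  -- step 3: `1 ↦ i'`, keeping `0, 5`
  set b₃ := σ₂.symm i' with hb₃
  have hb₃0 : b₃ ≠ 0 := by
    intro h; apply hii'; rw [← h2_0, ← h]; simp [hb₃]
  have hb₃5 : b₃ ≠ 5 := by
    intro h; apply hji'; rw [← h2_5, ← h]; simp [hb₃]
  set σ₃ : Equiv.Perm (Fin 6) := σ₂ * Equiv.swap 1 b₃ with hσ₃
  have h3_0 : σ₃ 0 = i := by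
    rw [hσ₃, Equiv.Perm.mul_apply, Equiv.swap_apply_of_ne_of_ne (by decide) hb₃0.symm, h2_0]
  have h3_5 : σ₃ 5 = j := by
    rw [hσ₃, Equiv.Perm.mul_apply, Equiv.swap_apply_of_ne_of_ne (by decide) hb₃5.symm, h2_5]
  have h3_1 : σ₃ 1 = i' := by
    rw [hσ₃, Equiv.Perm.mul_apply, Equiv.swap_apply_left]; simp [hb₃]
  -- step 4: `4 ↦ j'`, keeping `0, 5, 1`
  set b₄ := σ₃.symm j' with hb₄
  have hb₄0 : b₄ ≠ 0 := by
    intro h; apply hij'; rw [← h3_0, ← h]; simp [hb₄]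
  have hb₄5 : b₄ ≠ 5 := by
    intro h; apply hjj'; rw [← h3_5, ← h]; simp [hb₄]
  have hb₄1 : b₄ ≠ 1 := by
    intro h; apply hi'j'; rw [← h3_1, ← h]; simp [hb₄]
  set σ₄ : Equiv.Perm (Fin 6) := σ₃ * Equiv.swap 4 b₄ with hσ₄
  refine ⟨σ₄, ?_, ?_, ?_, ?_⟩
  · rw [hσ₄, Equiv.Perm.mul_apply, Equiv.swap_apply_of_ne_of_ne (by decide) hb₄0.symm, h3_0]
  · rw [hσ₄, Equiv.Perm.mul_apply, Equiv.swap_apply_of_ne_of_ne (by decide) hb₄5.symm, h3_5]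
  · rw [hσ₄, Equiv.Perm.mul_apply, Equiv.swap_apply_of_ne_of_ne (by decide) hb₄1.symm, h3_1]
  · rw [hσ₄, Equiv.Perm.mul_apply, Equiv.swap_apply_left]; simp [hb₄]

/-- Relabelling a pencil by a permutation of its letters does not change it. [folklore] -/
theorem pencil_sum_perm (σ : Equiv.Perm (Fin 6)) (δ : Fin 6 → ℝ) (V : Fin 6 → Matrix (Fin 2) (Fin 2) ℝ) (t : ℝ) :
    ∑ l, Real.exp (δ (σ l) * t) • V (σ l) = ∑ l, Real.exp (δ l * t) • V l :=
  Equiv.sum_comp σ (fun l => Real.exp (δ l * t) • V l)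

/-- The same in the `x`-currency. [folklore] -/
theorem rpow_pencil_sum_perm (σ : Equiv.Perm (Fin 6)) (δ : Fin 6 → ℝ) (V : Fin 6 → Matrix (Fin 2) (Fin 2) ℝ) (x : ℝ) :
    ∑ l, (x ^ (δ (σ l))) • V (σ l) = ∑ l, (x ^ (δ l)) • V l :=
  Equiv.sum_comp σ (fun l => (x ^ (δ l)) • V l)

/-! ## 2. Window theorems at permuted positions -/

/-- **NO TWENTY IN A WINDOW AT A TWO-WEYL-PAIR POINT (pairs at `σ 0, σ 5` and `σ 1, σ 4`), GIVEN THE STRATUM'S NON-DEGENERACY for the relabelled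
exponents — NO DOOR.** [this work] -/
theorem no_twenty_window_twoWeylPairs_of_nondeg_perm (σ : Equiv.Perm (Fin 6))
    (δs : ℕ → Fin 6 → ℝ) (δ0 : Fin 6 → ℝ) (hδ : ∀ l, Tendsto (fun ν => δs ν l) atTop (𝓝 (δ0 l)))
    (h50 : δ0 (σ 5) = δ0 (σ 0)) (h41 : δ0 (σ 4) = δ0 (σ 1))
    (hnd : ∀ W : Fin 6 → Matrix (Fin 2) (Fin 2) ℝ, (∀ l, (W l).IsSymm) → (∃ p q, polar (W p) (W q) ≠ 0) →
      ∃ t, ((Real.exp (δ0 (σ 0) * t)) • (W 0 + t • W 5) + (Real.exp (δ0 (σ 1) * t)) • (W 1 + t • W 4)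
        + ∑ k : Fin 2, (Real.exp (δ0 (σ k.succ.succ.castSucc.castSucc) * t)) • W k.succ.succ.castSucc.castSucc).det ≠ 0)
    (U : ℕ → Fin 6 → Matrix (Fin 2) (Fin 2) ℝ) (hU : ∀ ν l, (U ν l).IsSymm)
    (hne : ∀ ν, ∃ t, (∑ l, Real.exp (δs ν l * t) • U ν l).det ≠ 0)
    (A B : ℝ) (hz : ∀ ν, ∃ z : Fin 20 → ℝ, StrictMono z ∧ ∀ i, z i ∈ Set.Icc A B ∧ (∑ l, Real.exp (δs ν l * z i) • U ν l).det = 0) :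
    False := by
  refine no_twenty_window_twoWeylPairs_of_nondeg (fun ν l => δs ν (σ l)) (fun l => δ0 (σ l)) (fun l => hδ (σ l)) h50 h41 hnd
    (fun ν l => U ν (σ l)) (fun ν l => hU ν (σ l)) ?_ A B ?_
  · intro ν
    obtain ⟨t, ht⟩ := hne ν
    exact ⟨t, by rw [pencil_sum_perm]; exact ht⟩
  · intro ν
    obtain ⟨z, hz1, hz2⟩ := hz ν
    exact ⟨z, hz1, fun k => ⟨(hz2 k).1, by rw [pencil_sum_perm]; exact (hz2 k).2⟩⟩

/-- **NO BOUNDED-RATIO TWENTIES NEAR A TWO-WEYL-PAIR POINT (pairs at `σ 0, σ 5` and `σ 1, σ 4`), GIVEN THE STRATUM'S NON-DEGENERACY for the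
relabelled exponents — NO DOOR.** [this work] -/
theorem no_boundedRatio_twenties_twoWeylPairs_of_nondeg_perm (σ : Equiv.Perm (Fin 6))
    (δ0 : Fin 6 → ℝ) (h50 : δ0 (σ 5) = δ0 (σ 0)) (h41 : δ0 (σ 4) = δ0 (σ 1))
    (hnd : ∀ W : Fin 6 → Matrix (Fin 2) (Fin 2) ℝ, (∀ l, (W l).IsSymm) → (∃ p q, polar (W p) (W q) ≠ 0) →
      ∃ t, ((Real.exp (δ0 (σ 0) * t)) • (W 0 + t • W 5) + (Real.exp (δ0 (σ 1) * t)) • (W 1 + t • W 4)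
        + ∑ k : Fin 2, (Real.exp (δ0 (σ k.succ.succ.castSucc.castSucc) * t)) • W k.succ.succ.castSucc.castSucc).det ≠ 0)
    (δs : ℕ → Fin 6 → ℝ) (hδ : ∀ l, Tendsto (fun ν => δs ν l) atTop (𝓝 (δ0 l)))
    (S : ℕ → Fin 6 → Matrix (Fin 2) (Fin 2) ℝ) (hS : ∀ ν l, (S ν l).IsSymm)
    (hne : ∀ ν, ∃ y : ℝ, 0 < y ∧ (∑ l, (y ^ (δs ν l)) • S ν l).det ≠ 0)
    (R : ℝ) (x : ℕ → Fin 20 → ℝ) (hx : ∀ ν, StrictMono (x ν)) (hxpos : ∀ ν k, 0 < x ν k)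
    (hxR : ∀ ν k, x ν k ≤ R * x ν 0) (hroot : ∀ ν k, (∑ l, (x ν k ^ (δs ν l)) • S ν l).det = 0) : False := by
  refine no_boundedRatio_twenties_twoWeylPairs_of_nondeg (fun l => δ0 (σ l)) h50 h41 hnd (fun ν l => δs ν (σ l)) (fun l => hδ (σ l))
    (fun ν l => S ν (σ l)) (fun ν l => hS ν (σ l)) ?_ R x hx hxpos hxR ?_
  · intro ν
    obtain ⟨y, hy, hdet⟩ := hne ν
    exact ⟨y, hy, by rw [rpow_pencil_sum_perm]; exact hdet⟩
  · intro ν k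
    rw [rpow_pencil_sum_perm]; exact hroot ν k

/-! ## 3. The four strata at permuted positions -/

/-- **NO BOUNDED-RATIO TWENTIES NEAR A VALUE-GENERIC TWO-WEYL-PAIR POINT, pairs at `σ 0 = σ 5`, `σ 1 = σ 4` (as values) — NO DOOR.**
[this work] -/
theorem no_boundedRatio_twenties_twoWeylPairs_perm (σ : Equiv.Perm (Fin 6))
    (δ0 : Fin 6 → ℝ) (h50 : δ0 (σ 5) = δ0 (σ 0)) (h41 : δ0 (σ 4) = δ0 (σ 1))
    (hvg : ∀ a b c d : Fin 4, δ0 (σ a.castSucc.castSucc) + δ0 (σ b.castSucc.castSucc) = δ0 (σ c.castSucc.castSucc) + δ0 (σ d.castSucc.castSucc) →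
      (a = c ∧ b = d) ∨ (a = d ∧ b = c))
    (δs : ℕ → Fin 6 → ℝ) (hδ : ∀ l, Tendsto (fun ν => δs ν l) atTop (𝓝 (δ0 l)))
    (S : ℕ → Fin 6 → Matrix (Fin 2) (Fin 2) ℝ) (hS : ∀ ν l, (S ν l).IsSymm)
    (hne : ∀ ν, ∃ y : ℝ, 0 < y ∧ (∑ l, (y ^ (δs ν l)) • S ν l).det ≠ 0)
    (R : ℝ) (x : ℕ → Fin 20 → ℝ) (hx : ∀ ν, StrictMono (x ν)) (hxpos : ∀ ν k, 0 < x ν k)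
    (hxR : ∀ ν k, x ν k ≤ R * x ν 0) (hroot : ∀ ν k, (∑ l, (x ν k ^ (δs ν l)) • S ν l).det = 0) : False :=
  no_boundedRatio_twenties_twoWeylPairs_of_nondeg_perm σ δ0 h50 h41
    (fun W hWs hWne => doublyConfluentDet_ne_zero_of_polar_ne_zero (fun l => δ0 (σ l)) h50 h41 hvg W hWs hWne)
    δs hδ S hS hne R x hx hxpos hxR hroot

/-- **… on the wall (c1) `δ0 (σ 0) + δ0 (σ 1) = δ0 (σ 2) + δ0 (σ 3)` — NO DOOR.** [this work] -/
theorem no_boundedRatio_twenties_twoWeylPairs_wallC1_perm (σ : Equiv.Perm (Fin 6))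
    (δ0 : Fin 6 → ℝ) (h50 : δ0 (σ 5) = δ0 (σ 0)) (h41 : δ0 (σ 4) = δ0 (σ 1)) (hrel : δ0 (σ 0) + δ0 (σ 1) = δ0 (σ 2) + δ0 (σ 3))
    (hgen : ∀ a b c e : Fin 4, δ0 (σ a.castSucc.castSucc) + δ0 (σ b.castSucc.castSucc) = δ0 (σ c.castSucc.castSucc) + δ0 (σ e.castSucc.castSucc) →
      (a = c ∧ b = e) ∨ (a = e ∧ b = c) ∨
        (((a = 0 ∧ b = 1) ∨ (a = 1 ∧ b = 0)) ∧ ((c = 2 ∧ e = 3) ∨ (c = 3 ∧ e = 2))) ∨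
        (((a = 2 ∧ b = 3) ∨ (a = 3 ∧ b = 2)) ∧ ((c = 0 ∧ e = 1) ∨ (c = 1 ∧ e = 0))))
    (δs : ℕ → Fin 6 → ℝ) (hδ : ∀ l, Tendsto (fun ν => δs ν l) atTop (𝓝 (δ0 l)))
    (S : ℕ → Fin 6 → Matrix (Fin 2) (Fin 2) ℝ) (hS : ∀ ν l, (S ν l).IsSymm)
    (hne : ∀ ν, ∃ y : ℝ, 0 < y ∧ (∑ l, (y ^ (δs ν l)) • S ν l).det ≠ 0)
    (R : ℝ) (x : ℕ → Fin 20 → ℝ) (hx : ∀ ν, StrictMono (x ν)) (hxpos : ∀ ν k, 0 < x ν k)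
    (hxR : ∀ ν k, x ν k ≤ R * x ν 0) (hroot : ∀ ν k, (∑ l, (x ν k ^ (δs ν l)) • S ν l).det = 0) : False :=
  no_boundedRatio_twenties_twoWeylPairs_of_nondeg_perm σ δ0 h50 h41
    (fun W hWs hWne => doublyConfluentDet_ne_zero_of_polar_ne_zero_wallC1 (fun l => δ0 (σ l)) h50 h41 hrel hgen W hWs hWne)
    δs hδ S hS hne R x hx hxpos hxR hroot

/-- **… on the wall (c2) `δ0 (σ 0) + δ0 (σ 2) = δ0 (σ 1) + δ0 (σ 3)` — NO DOOR.** [this work] -/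
theorem no_boundedRatio_twenties_twoWeylPairs_wallC2_perm (σ : Equiv.Perm (Fin 6))
    (δ0 : Fin 6 → ℝ) (h50 : δ0 (σ 5) = δ0 (σ 0)) (h41 : δ0 (σ 4) = δ0 (σ 1)) (hrel : δ0 (σ 0) + δ0 (σ 2) = δ0 (σ 1) + δ0 (σ 3))
    (hgen : ∀ a b c e : Fin 4, δ0 (σ a.castSucc.castSucc) + δ0 (σ b.castSucc.castSucc) = δ0 (σ c.castSucc.castSucc) + δ0 (σ e.castSucc.castSucc) →
      (a = c ∧ b = e) ∨ (a = e ∧ b = c) ∨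
        (((a = 0 ∧ b = 2) ∨ (a = 2 ∧ b = 0)) ∧ ((c = 1 ∧ e = 3) ∨ (c = 3 ∧ e = 1))) ∨
        (((a = 1 ∧ b = 3) ∨ (a = 3 ∧ b = 1)) ∧ ((c = 0 ∧ e = 2) ∨ (c = 2 ∧ e = 0))))
    (δs : ℕ → Fin 6 → ℝ) (hδ : ∀ l, Tendsto (fun ν => δs ν l) atTop (𝓝 (δ0 l)))
    (S : ℕ → Fin 6 → Matrix (Fin 2) (Fin 2) ℝ) (hS : ∀ ν l, (S ν l).IsSymm)
    (hne : ∀ ν, ∃ y : ℝ, 0 < y ∧ (∑ l, (y ^ (δs ν l)) • S ν l).det ≠ 0)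
    (R : ℝ) (x : ℕ → Fin 20 → ℝ) (hx : ∀ ν, StrictMono (x ν)) (hxpos : ∀ ν k, 0 < x ν k)
    (hxR : ∀ ν k, x ν k ≤ R * x ν 0) (hroot : ∀ ν k, (∑ l, (x ν k ^ (δs ν l)) • S ν l).det = 0) : False :=
  no_boundedRatio_twenties_twoWeylPairs_of_nondeg_perm σ δ0 h50 h41
    (fun W hWs hWne => doublyConfluentDet_ne_zero_of_polar_ne_zero_wallC2 (fun l => δ0 (σ l)) h50 h41 hrel hgen W hWs hWne)
    δs hδ S hS hne R x hx hxpos hxR hroot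

/-- **… on the wall (c3) `δ0 (σ 0) + δ0 (σ 3) = δ0 (σ 1) + δ0 (σ 2)` — NO DOOR.** [this work] -/
theorem no_boundedRatio_twenties_twoWeylPairs_wallC3_perm (σ : Equiv.Perm (Fin 6))
    (δ0 : Fin 6 → ℝ) (h50 : δ0 (σ 5) = δ0 (σ 0)) (h41 : δ0 (σ 4) = δ0 (σ 1)) (hrel : δ0 (σ 0) + δ0 (σ 3) = δ0 (σ 1) + δ0 (σ 2))
    (hgen : ∀ a b c e : Fin 4, δ0 (σ a.castSucc.castSucc) + δ0 (σ b.castSucc.castSucc) = δ0 (σ c.castSucc.castSucc) + δ0 (σ e.castSucc.castSucc) →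
      (a = c ∧ b = e) ∨ (a = e ∧ b = c) ∨
        (((a = 0 ∧ b = 3) ∨ (a = 3 ∧ b = 0)) ∧ ((c = 1 ∧ e = 2) ∨ (c = 2 ∧ e = 1))) ∨
        (((a = 1 ∧ b = 2) ∨ (a = 2 ∧ b = 1)) ∧ ((c = 0 ∧ e = 3) ∨ (c = 3 ∧ e = 0))))
    (δs : ℕ → Fin 6 → ℝ) (hδ : ∀ l, Tendsto (fun ν => δs ν l) atTop (𝓝 (δ0 l)))
    (S : ℕ → Fin 6 → Matrix (Fin 2) (Fin 2) ℝ) (hS : ∀ ν l, (S ν l).IsSymm)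
    (hne : ∀ ν, ∃ y : ℝ, 0 < y ∧ (∑ l, (y ^ (δs ν l)) • S ν l).det ≠ 0)
    (R : ℝ) (x : ℕ → Fin 20 → ℝ) (hx : ∀ ν, StrictMono (x ν)) (hxpos : ∀ ν k, 0 < x ν k)
    (hxR : ∀ ν k, x ν k ≤ R * x ν 0) (hroot : ∀ ν k, (∑ l, (x ν k ^ (δs ν l)) • S ν l).det = 0) : False :=
  no_boundedRatio_twenties_twoWeylPairs_of_nondeg_perm σ δ0 h50 h41
    (fun W hWs hWne => doublyConfluentDet_ne_zero_of_polar_ne_zero_wallC3 (fun l => δ0 (σ l)) h50 h41 hrel hgen W hWs hWne)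
    δs hδ S hS hne R x hx hxpos hxR hroot

end Summit.ValiantsHypothesis.ValiantsHypothesis.Theorems.LacunarySymmetroidMatrixDescartes.WallBubbling
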